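import Mathlib
import HarnessLib
import Summits.CriticalPhenomena.CardyFormulaZ2.Theorems.CardyComplexConeEdgeCoherenceDefs

/-!
# Vocabulary of line `Sketch`, composition `LeeYang` (winding-fugacity transfer), for crux `EdgeCoherence`
(item stmt-CriticalPhenomena-11385)

Route `CardyComplexCone` (sub-problem `CriticalPhenomena/CardyFormulaZ2`), crux
`Summit.CriticalPhenomena.CardyFormulaZ2.Theses.CardyComplexCone.EdgeCoherence`.
This is the second definitions module of line `Sketch` (lead `prover-line-stmt-CriticalPhenomena-11385-c1-0`):
after the one-cut composition `FixedRadiusCut` ended `line-dead` (`Cruxes/EdgeCoherence/Lines/Sketch-dead.md`), the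
line is continued on the OTHER composition of the planner's sketch (`Cruxes/EdgeCoherence/SketchIdeator2.lean`,
`FirstLemmaLeeYang`, idea card `Cruxes/EdgeCoherence/Ideas/lee-yang-winding-fugacity.md`):

* the four class harmonics `H_k(v) = harmonic Λ δ k v` (first module) are four values of ONE positive-coefficient
  Laurent polynomial in a winding fugacity `ζ`, the **winding-index generating function**
  `Z(ζ) = indexGF E δ v ζ = E[ Σ_{darts of γ at v} ζ^{m} ]`, `m = W/(π/2) ∈ ℤ` the lifted quarter-turn index of
  the dart (`W ∈ (π/2)ℤ` exactly: every step of the medial exploration turns by `±π/2`):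
  `H_k(v) = i^{k c₀} · Z(ζ₀ i^k)`, `ζ₀ = e^{-iπ/6}` (`zeta0`), `c₀` the class of the start corner
  (stub `identification`);
* `Z` is holomorphic off the origin (stub `laurent`), so the alias ratios `R_k = Z(· i^k)/Z` are analytic on the
  thin region `arcRegion η ∋ 1, ζ₀` (exp-image of the open rectangle `logRect η`) as soon as they are BOUNDED there
  (stub `division`: analytic division under domination), and Vitali's theorem (tree:
  `Literature.Analysis.Complex.exists_tendstoLocallyUniformlyOn_of_frequently_tendsto`) transports smallness from
  the positive fugacity axis to `ζ₀` (stub `transfer`);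
* the three OPEN inputs are the idea card's bets, copied from the planner's sketch with `indexGF` read per datum:
  `domination` (= `ArcRotatedDomination`: the rotated values never dominate on a thin neighbourhood of the arc from `1`
  to `ζ₀`), `equidistribution` (= `TiltedClassEquidistribution`: at real fugacity the four classes equidistribute —
  a ratio limit for a POSITIVE measure) and `envelope0` (the spin-`1/3` envelope `‖H₀‖ ≤ C δ^{1/3}`, i.e.
  `EdgePrecompact` (i) summed over the four classes).

Everything here is either a definition, a `Sig.stub_*` statement (a `def … : Prop`, proved BY NAME in a helper file
`Theorems/CardyComplexConeEdgeCoherenceLeeYang<Stub>.lean --supports stmt-CriticalPhenomena-11385`; nothing is asserted),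
or an elementary proved lemma about the region `arcRegion η` shared by the helper files (open, preconnected, exp-chart
membership, `1, ζ₀ ∈`, monotone in `η`).

Sources: idea card `lee-yang-winding-fugacity` (ideator 2, 2026-08-15) and its data (kit j006422–j006424, j006460/1);
H. Duminil-Copin, S. Smirnov, *Conformal invariance of lattice models*, Clay Math. Proc. 15 (2012) §8 (Conj. 8.7);
S. Smirnov, Ann. of Math. 172 (2010) §2.2 (the phase `e^{-iσW}`); E. C. Titchmarsh, *The Theory of Functions* §5.21
(Vitali).
-/

noncomputable section

namespace Summit.CriticalPhenomena.CardyFormulaZ2.Cruxes.EdgeCoherence.LeeYang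

open scoped BigOperators Topology
open Filter Set MeasureTheory
open Literature.Probability.LatticeModels Literature.Probability.RandomPlanarGeometry
open Literature.Probability.Percolation (BondConfig bondPercolation half)
open Summit.CriticalPhenomena.CardyFormulaZ2.Theses.CardyComplexCone (EdgeCoherence EdgePrecompact)
open Summit.CriticalPhenomena.CardyFormulaZ2.Cruxes.EdgeCoherence.FixedRadiusCut
  (cornerObs harmonic HarmonicVanishing startCorner)

/-! ### Vocabulary: the winding-index generating function, the physical fugacity, the region -/

/-- **The winding-index generating function** of the darts of the exploration path of the datum `E` at the primal
vertex `v`, read at mesh `δ`: `Z(ζ) = E[ Σ_{c : Fin 4} Σ_{passages k of γ along the corner (v, faceAt v c)} ζ^{m_k} ]`,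
`m_k = round(W_k / (π/2)) ∈ ℤ` the lifted quarter-turn index of the passage (`W_k` the winding of the polyline prefix
ending with that dart — VERBATIM the crux integrand with the phase `exp(-(i/3) W_k) = ζ₀^{m_k}` replaced by `ζ^{m_k}`;
`W_k ∈ (π/2)ℤ` exactly, so `round` only casts). A Laurent polynomial in `ζ` with non-negative coefficients
(finitely many darts at each mesh); `Polyline.winding` is written explicitly (name-resolution caveat of the first
definitions module). -/
def indexGF (E : DiscreteDobrushin) (δ : ℝ) (v : Site 2) (ζ : ℂ) : ℂ :=
  ∫ ω, (let γ := Literature.Probability.LatticeModels.medialExploration E ω;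
    ∑ c : Fin 4, ∑ k ∈ (Finset.range γ.length).filter (fun k => γ[k]? = some
      (Literature.Probability.LatticeModels.cornerSource v (faceAt v c)) ∧ γ[k + 1]? = some
      (Literature.Probability.LatticeModels.cornerTarget v (faceAt v c))),
      ζ ^ (round (Literature.Probability.LatticeModels.Polyline.winding ((γ.map
        (Literature.Probability.LatticeModels.medialPoint δ)).take (k + 2)) / (Real.pi / 2)) : ℤ))
    ∂(bondPercolation (zdGraph 2) half)

/-- **The physical fugacity** `ζ₀ = e^{-iπ/6}`: the spin-`1/3` phase of one left quarter-turn
(`exp(-(i/3)·(π/2)) = ζ₀`), so that `H_k(v) = i^{k c₀} Z(ζ₀ i^k)`. -/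
def zeta0 : ℂ := Complex.exp (((-(Real.pi / 6) : ℝ) : ℂ) * Complex.I)

/-- The open rectangle of logarithms `(log(1-η), log(1+η)) × (-π/6-η, η)` (real part = log of the fugacity modulus,
imaginary part = its argument). -/
def logRect (η : ℝ) : Set ℂ :=
  {w | Real.log (1 - η) < w.re ∧ w.re < Real.log (1 + η) ∧ -(Real.pi / 6) - η < w.im ∧ w.im < η}

/-- **The transfer region** `U_η = exp(logRect η) = {x e^{iθ} : |x - 1| < η, -π/6 - η < θ < η}`: a thin open,
connected neighbourhood of the arc of the unit circle from the positive axis (`θ = 0`, where the tilted measure is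
positive) to the physical fugacity `ζ₀` (`θ = -π/6`). -/
def arcRegion (η : ℝ) : Set ℂ := Complex.exp '' logRect η

/-! ### The seven stub statements of the composition (nothing asserted) -/

/-- STUB statement — **LAURENT** (provable now, M): for admissible data the generating function is holomorphic off
the origin (it is a finite sum `Σ_m p_m ζ^m`, `m ∈ ℤ`: the exploration reads only the finitely many edges of `Ω_δ`,
so the integral is a finite sum over configurations of finite dart sums). -/
def Sig.stub_laurent : Prop :=
  ∀ (E : DiscreteDobrushin) (δ : ℝ) (v : Site 2), E.IsZdAdmissible →
    DifferentiableOn ℂ (indexGF E δ v) {z : ℂ | z ≠ 0}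

/-- STUB statement — **IDENTIFICATION** (provable now, M): the class harmonics are the rotated values of the
generating function at the physical fugacity, `H_k(v) = i^{k·c₀} · Z(ζ₀ · i^k)`, `c₀` the class of the start corner:
along the exploration orbit the `n`-th dart has phase `ζ₀^{S_n}` (`Negative.dartPhaseSum_eq_exp_turnSign`,
`S_n = Σ_{i<n} turnSign`) and class `c₀ + S_n (mod 4)` (`FermionicObservableSums.snd_cornerOrbit_eq`), so
`i^{k c_n} ζ₀^{S_n} = i^{k c₀} (ζ₀ i^k)^{S_n}`. -/
def Sig.stub_identification : Prop :=
  ∀ (E : DiscreteDobrushin) (δ : ℝ), E.IsZdAdmissible → δ ≠ 0 → ∀ (v : Site 2) (k : ℕ),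
    harmonic (fun _ => E) δ k v =
      Complex.I ^ (k * ((startCorner E).2 : ℕ)) * indexGF E δ v (zeta0 * Complex.I ^ k)

/-- STUB statement — **DIVISION** (pure complex analysis, provable now, M): analytic division under domination on
the region. If `f, g` are holomorphic on `U_η`, `‖f‖ ≤ M‖g‖` there and `‖f‖ ≤ ε‖g‖` on the real segment, then
`f = h·g` with `h` holomorphic on `U_η`, `‖h‖ ≤ M` on `U_η` and `‖h‖ ≤ ε` on the segment (if `g ≢ 0`: at a zero of
`g` of order `q`, domination forces `f` to vanish to order `≥ q`, so `f/g` extends analytically; the segment bound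
extends over the isolated real zeros of `g` by continuity; if `g ≡ 0` on the connected `U_η`, take `h = 0`). -/
def Sig.stub_division : Prop :=
  ∀ (η M ε : ℝ), 0 < η → η ≤ 1 / 2 → 0 ≤ M → 0 ≤ ε → ∀ f g : ℂ → ℂ,
    DifferentiableOn ℂ f (arcRegion η) → DifferentiableOn ℂ g (arcRegion η) →
    (∀ z ∈ arcRegion η, ‖f z‖ ≤ M * ‖g z‖) →
    (∀ x : ℝ, |x - 1| < η → ‖f x‖ ≤ ε * ‖g x‖) →
    ∃ h : ℂ → ℂ, DifferentiableOn ℂ h (arcRegion η) ∧ (∀ z ∈ arcRegion η, f z = h z * g z) ∧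
      (∀ z ∈ arcRegion η, ‖h z‖ ≤ M) ∧ (∀ x : ℝ, |x - 1| < η → ‖h (x : ℂ)‖ ≤ ε)

/-- STUB statement — **TRANSFER** (pure complex analysis, provable now, S–M; Vitali–Porter): for fixed `η, M` and
`ε' > 0` there is `ε > 0` such that every `h` holomorphic on `U_η` with `‖h‖ ≤ M` on `U_η` and `‖h‖ ≤ ε` on the real
segment `|x - 1| < η` has `‖h(ζ₀)‖ ≤ ε'`. (Contradiction + Vitali: a sequence `h_n` with segment bounds `1/(n+1)` and
`‖h_n(ζ₀)‖ > ε'` is bounded by `M`, converges to `0` on the segment, hence — `U_η` open and connected, tree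
`exists_tendstoLocallyUniformlyOn_of_frequently_tendsto` + identity theorem — locally uniformly to `0`, absurd at `ζ₀`.)
Uniformity in `h` is exactly what the family `{R_k(·; δ, v)}` needs. -/
def Sig.stub_transfer : Prop :=
  ∀ (η M : ℝ), 0 < η → η ≤ 1 / 2 → 0 ≤ M → ∀ ε' > (0:ℝ), ∃ ε > (0:ℝ), ∀ h : ℂ → ℂ,
    DifferentiableOn ℂ h (arcRegion η) → (∀ z ∈ arcRegion η, ‖h z‖ ≤ M) →
    (∀ x : ℝ, |x - 1| < η → ‖h (x : ℂ)‖ ≤ ε) → ‖h zeta0‖ ≤ ε'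

/-- STUB statement — **DOMINATION** (OPEN — the card's bet `ArcRotatedDomination`, per datum `Λ δ`): there are
`M` and `η > 0` such that for every domain, family (guards) and compact `K ⊂ D`, eventually in `δ`, at every vertex
over `K`, on the region `|x - 1| < η`, `-π/6 - η < θ < η` the three rotated values never dominate:
`‖Z(x e^{iθ} i^k)‖ ≤ M ‖Z(x e^{iθ})‖`, `k = 1,2,3` (bounded, not small; data: `M = .63 → .50 → .37 → .33` as
`Var(m)` grows, j006423/4, j006460/1). -/
def Sig.stub_domination : Prop :=
  ∃ M η : ℝ, 0 < η ∧ ∀ (D : DobrushinDomain) (Λ : ℝ → DiscreteDobrushin), (∀ δ, (Λ δ).Ω = D.carrier) →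
    (∀ δ, (Λ δ).δ = δ) → (∀ᶠ δ in 𝓝[>] (0:ℝ), (Λ δ).IsZdAdmissible) →
    ∀ K : Set ℂ, IsCompact K → K ⊆ D.carrier → ∀ᶠ δ in 𝓝[>] (0:ℝ),
      ∀ v : Site 2, meshPoint δ v ∈ K → ∀ x θ : ℝ, |x - 1| < η → -(Real.pi / 6) - η < θ → θ < η →
        ∀ k ∈ ({1, 2, 3} : Finset ℕ),
          ‖indexGF (Λ δ) δ v ((x : ℂ) * Complex.exp ((θ : ℂ) * Complex.I) * Complex.I ^ k)‖ ≤
            M * ‖indexGF (Λ δ) δ v ((x : ℂ) * Complex.exp ((θ : ℂ) * Complex.I))‖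

/-- STUB statement — **EQUIDISTRIBUTION** (OPEN — the card's positive input `TiltedClassEquidistribution`): for real
fugacities `x` near `1` the rotated values are negligible, `Z(x i^k) = o(Z(x))`, `k = 1,2,3`, eventually in `δ`,
locally uniformly — under the positive tilt `x^m` the four dart classes at `v` are asymptotically equidistributed
(a ratio limit for a POSITIVE measure: tilted two-arm incipient-infinite-cluster uniqueness + `π/2`-rotation symmetry). -/
def Sig.stub_equidistribution : Prop :=
  ∃ η > (0:ℝ), ∀ (D : DobrushinDomain) (Λ : ℝ → DiscreteDobrushin), (∀ δ, (Λ δ).Ω = D.carrier) →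
    (∀ δ, (Λ δ).δ = δ) → (∀ᶠ δ in 𝓝[>] (0:ℝ), (Λ δ).IsZdAdmissible) →
    ∀ K : Set ℂ, IsCompact K → K ⊆ D.carrier → ∀ ε > (0:ℝ), ∀ᶠ δ in 𝓝[>] (0:ℝ),
      ∀ v : Site 2, meshPoint δ v ∈ K → ∀ x : ℝ, |x - 1| < η → ∀ k ∈ ({1, 2, 3} : Finset ℕ),
        ‖indexGF (Λ δ) δ v ((x : ℂ) * Complex.I ^ k)‖ ≤ ε * ‖indexGF (Λ δ) δ v (x : ℂ)‖

/-- STUB statement — **ENVELOPE of `H₀`** (OPEN as a crux-#3 input: it is `EdgePrecompact` (i) summed over the four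
classes, `envelope0_of_edgePrecompact`): for every domain, family (guards) and compact `K ⊂ D` there is `C` with
`‖H₀(v)‖ ≤ C δ^{1/3}` eventually in `δ` at every vertex over `K`. -/
def Sig.stub_envelope0 : Prop :=
  ∀ (D : DobrushinDomain) (Λ : ℝ → DiscreteDobrushin), (∀ δ, (Λ δ).Ω = D.carrier) →
    (∀ δ, (Λ δ).δ = δ) → (∀ᶠ δ in 𝓝[>] (0:ℝ), (Λ δ).IsZdAdmissible) →
    ∀ K : Set ℂ, IsCompact K → K ⊆ D.carrier → ∃ C : ℝ, ∀ᶠ δ in 𝓝[>] (0:ℝ),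
      ∀ v : Site 2, meshPoint δ v ∈ K → ‖harmonic Λ δ 0 v‖ ≤ C * δ ^ ((1:ℝ) / 3)

/-! ### Elementary facts about the region, shared by the helper files -/

/-- The rectangle of logarithms is open. -/
theorem isOpen_logRect (η : ℝ) : IsOpen (logRect η) := by
  have h1 : IsOpen {w : ℂ | Real.log (1 - η) < w.re} := isOpen_lt continuous_const Complex.continuous_re
  have h2 : IsOpen {w : ℂ | w.re < Real.log (1 + η)} := isOpen_lt Complex.continuous_re continuous_const
  have h3 : IsOpen {w : ℂ | -(Real.pi / 6) - η < w.im} := isOpen_lt continuous_const Complex.continuous_im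
  have h4 : IsOpen {w : ℂ | w.im < η} := isOpen_lt Complex.continuous_im continuous_const
  have : logRect η = {w : ℂ | Real.log (1 - η) < w.re} ∩ {w : ℂ | w.re < Real.log (1 + η)} ∩
      {w : ℂ | -(Real.pi / 6) - η < w.im} ∩ {w : ℂ | w.im < η} := by
    ext w; simp [logRect, and_assoc]
  rw [this]
  exact ((h1.inter h2).inter h3).inter h4

/-- The rectangle of logarithms is convex. -/
theorem convex_logRect (η : ℝ) : Convex ℝ (logRect η) := by
  have h1 : Convex ℝ {w : ℂ | Real.log (1 - η) < w.re} := convex_halfSpace_re_gt _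
  have h2 : Convex ℝ {w : ℂ | w.re < Real.log (1 + η)} := convex_halfSpace_re_lt _
  have h3 : Convex ℝ {w : ℂ | -(Real.pi / 6) - η < w.im} := convex_halfSpace_im_gt _
  have h4 : Convex ℝ {w : ℂ | w.im < η} := convex_halfSpace_im_lt _
  have : logRect η = {w : ℂ | Real.log (1 - η) < w.re} ∩ {w : ℂ | w.re < Real.log (1 + η)} ∩
      {w : ℂ | -(Real.pi / 6) - η < w.im} ∩ {w : ℂ | w.im < η} := by
    ext w; simp [logRect, and_assoc]
  rw [this]
  exact ((h1.inter h2).inter h3).inter h4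

/-- **The transfer region is open** (`exp` is an open map). -/
theorem isOpen_arcRegion (η : ℝ) : IsOpen (arcRegion η) :=
  Complex.isOpenMap_exp _ (isOpen_logRect η)

/-- **The transfer region is preconnected** (continuous image of a convex set). -/
theorem isPreconnected_arcRegion (η : ℝ) : IsPreconnected (arcRegion η) :=
  (convex_logRect η).isPreconnected.image _ Complex.continuous_exp.continuousOn

/-- Points of the transfer region are non-zero. -/
theorem ne_zero_of_mem_arcRegion {η : ℝ} {z : ℂ} (hz : z ∈ arcRegion η) : z ≠ 0 := by
  obtain ⟨w, -, rfl⟩ := hz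
  exact Complex.exp_ne_zero w

/-- The transfer region lies in the punctured plane. -/
theorem arcRegion_subset_compl_zero (η : ℝ) : arcRegion η ⊆ {z : ℂ | z ≠ 0} :=
  fun _ hz => ne_zero_of_mem_arcRegion hz

/-- **Polar chart**: for `|x - 1| < η ≤ 1/2` and `-π/6 - η < θ < η`, the point `x e^{iθ}` lies in `U_η`. -/
theorem mul_exp_mem_arcRegion {η x θ : ℝ} (hη : η ≤ 1 / 2) (hx : |x - 1| < η)
    (hθ₁ : -(Real.pi / 6) - η < θ) (hθ₂ : θ < η) :
    (x : ℂ) * Complex.exp ((θ : ℂ) * Complex.I) ∈ arcRegion η := by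
  obtain ⟨hx₁, hx₂⟩ := abs_sub_lt_iff.1 hx
  have hx0 : 0 < x := by linarith
  refine ⟨(Real.log x : ℂ) + (θ : ℂ) * Complex.I, ⟨?_, ?_, ?_, ?_⟩, ?_⟩
  · simpa using Real.log_lt_log (by linarith) (by linarith : 1 - η < x)
  · simpa using Real.log_lt_log hx0 (by linarith : x < 1 + η)
  · simpa using hθ₁
  · simpa using hθ₂
  · rw [Complex.exp_add, ← Complex.ofReal_exp, Real.exp_log hx0]

/-- **Polar description** of the region: for `0 < η ≤ 1/2`, `z ∈ U_η` iff `z = x e^{iθ}` with `|x - 1| < η` and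
`-π/6 - η < θ < η`. -/
theorem mem_arcRegion_iff {η : ℝ} (hη0 : 0 < η) (hη : η ≤ 1 / 2) {z : ℂ} :
    z ∈ arcRegion η ↔ ∃ x θ : ℝ, |x - 1| < η ∧ -(Real.pi / 6) - η < θ ∧ θ < η ∧
      z = (x : ℂ) * Complex.exp ((θ : ℂ) * Complex.I) := by
  constructor
  · rintro ⟨w, ⟨h1, h2, h3, h4⟩, rfl⟩
    refine ⟨Real.exp w.re, w.im, ?_, h3, h4, ?_⟩
    · rw [abs_sub_lt_iff]
      constructor
      · have := Real.exp_lt_exp.2 h2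
        rw [Real.exp_log (by linarith : (0:ℝ) < 1 + η)] at this
        linarith
      · have := Real.exp_lt_exp.2 h1
        rw [Real.exp_log (by linarith : (0:ℝ) < 1 - η)] at this
        linarith
    · conv_lhs => rw [← Complex.re_add_im w]
      rw [Complex.exp_add, Complex.ofReal_exp]
  · rintro ⟨x, θ, hx, hθ₁, hθ₂, rfl⟩
    exact mul_exp_mem_arcRegion hη hx hθ₁ hθ₂

/-- Real fugacities near `1` lie in the region. -/
theorem ofReal_mem_arcRegion {η x : ℝ} (hη0 : 0 < η) (hη : η ≤ 1 / 2) (hx : |x - 1| < η) :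
    (x : ℂ) ∈ arcRegion η := by
  have h := mul_exp_mem_arcRegion (θ := 0) hη hx (by linarith [Real.pi_pos]) hη0
  simpa using h

/-- `1` lies in the region. -/
theorem one_mem_arcRegion {η : ℝ} (hη0 : 0 < η) (hη : η ≤ 1 / 2) : (1 : ℂ) ∈ arcRegion η := by
  have h := ofReal_mem_arcRegion (x := 1) hη0 hη (by simpa using hη0)
  simpa using h

/-- **The physical fugacity lies in the region.** -/
theorem zeta0_mem_arcRegion {η : ℝ} (hη0 : 0 < η) (hη : η ≤ 1 / 2) : zeta0 ∈ arcRegion η := by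
  have h := mul_exp_mem_arcRegion (x := 1) (θ := -(Real.pi / 6)) hη (by simpa using hη0)
    (by linarith) (by linarith [Real.pi_pos])
  simpa [zeta0] using h

/-- `ζ₀` is unimodular. -/
theorem norm_zeta0 : ‖zeta0‖ = 1 := by
  rw [zeta0, Complex.norm_exp_ofReal_mul_I]

/-- `ζ₀ ≠ 0`. -/
theorem zeta0_ne_zero : zeta0 ≠ 0 := Complex.exp_ne_zero _

/-- The region grows with `η` (for `0 < η ≤ η' ≤ 1/2`, so that the logarithms are defined). -/
theorem arcRegion_mono {η η' : ℝ} (hη : 0 < η) (h : η ≤ η') (hη' : η' ≤ 1 / 2) :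
    arcRegion η ⊆ arcRegion η' := by
  rintro _ ⟨w, ⟨h1, h2, h3, h4⟩, rfl⟩
  refine ⟨w, ⟨?_, ?_, ?_, ?_⟩, rfl⟩
  · exact lt_of_le_of_lt (Real.log_le_log (by linarith) (by linarith)) h1
  · exact lt_of_lt_of_le h2 (Real.log_le_log (by linarith) (by linarith))
  · linarith
  · linarith

/-! ### Glue (proved): the envelope of `H₀` is `EdgePrecompact` (i) summed over the four classes -/

/-- `EdgePrecompact → Sig.stub_envelope0`: `H₀(v) = Σ_c E_δ(v, faceAt v c)` and each corner value is
`≤ C δ^{1/3}` eventually by clause (i) of `EdgePrecompact` (`E δ v f` there is `cornerObs (Λ δ) δ v f`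
definitionally; `faceAt v c` is cornered at `v`, `isCorner_faceAt`), so `‖H₀(v)‖ ≤ 4C δ^{1/3}`. -/
theorem envelope0_of_edgePrecompact : EdgePrecompact → Sig.stub_envelope0 := by
  intro hP D Λ hΩ hδ hadm K hK hKD
  obtain ⟨C, hC⟩ := (hP D Λ hΩ hδ hadm K hK hKD).1
  refine ⟨4 * C, ?_⟩
  filter_upwards [hC] with δ hCδ v hv
  have hb : ∀ c : Fin 4, ‖cornerObs (Λ δ) δ v (faceAt v c)‖ ≤ C * δ ^ ((1:ℝ) / 3) := fun c => by
    -- `E δ v f` of `EdgePrecompact` spells `LatticeModels.winding`, `cornerObs` spells `Polyline.winding`: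
    -- equal by `Polyline.winding_eq_winding'` (no longer definitionally)
    have h := hCδ v (faceAt v c) (isCorner_faceAt v c) hv
    simpa only [cornerObs, Literature.Probability.LatticeModels.Polyline.winding_eq_winding'] using h
  unfold FixedRadiusCut.harmonic
  calc ‖∑ c : Fin 4, Complex.I ^ (0 * (c : ℕ)) * cornerObs (Λ δ) δ v (faceAt v c)‖
      ≤ ∑ c : Fin 4, ‖Complex.I ^ (0 * (c : ℕ)) * cornerObs (Λ δ) δ v (faceAt v c)‖ := norm_sum_le _ _
    _ = ∑ c : Fin 4, ‖cornerObs (Λ δ) δ v (faceAt v c)‖ := by simp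
    _ ≤ ∑ _c : Fin 4, C * δ ^ ((1:ℝ) / 3) := Finset.sum_le_sum fun c _ => hb c
    _ = 4 * C * δ ^ ((1:ℝ) / 3) := by simp [Finset.sum_const, Finset.card_univ]; ring

end Summit.CriticalPhenomena.CardyFormulaZ2.Cruxes.EdgeCoherence.LeeYang

end
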